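import Literature.Probability.Distributions.RieszMarkovKernel
import Mathlib.MeasureTheory.Measure.GiryMonad
import Mathlib.MeasureTheory.Constructions.BorelSpace.Metrizable
import HarnessLib

/-!
# Measurable Riesz–Markov kernels from measurable families of test functionals

Topic `Literature/Probability/Distributions`; the kernel (measurable-family) version of
`RieszMarkovKernel.lean`, written for the Riesz–Markov step of the Garban–Pete–Schramm
pivotal-kernel limit of lattice models (route
`Summits/CriticalPhenomena/CardyFormulaZ2/Theses/CardyMeckeFlip`, crux `FlipErgodicityZ2`, stub
"joint multi-cutoff pivotal-kernel limit with a measurable kernel"), but model-free.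

Setting: `Ω` a measurable space (with a measure `μ` for the a.e. version), `Y` a second
countable locally compact `T2` Borel space (e.g. `ℂ`), `𝓓 ⊆ C_c(Y, ℝ)` closed under `+` and
rational multiples and dominated-dense (hypotheses stated verbatim as the conclusion of
`exists_countable_dominatedDense` in `CountableTestFamily.lean`), and `T : Ω → C_c(Y, ℝ) → ℝ`
with `S ↦ T S f` measurable for `f ∈ 𝓓`.

**Results.**
* `abs_integral_sub_le_of_abs_sub_le` — the domination estimate `|∫ f dm - ∫ g dm| ≤ η ∫ χ dm`
  for `|f - g| ≤ η χ` (`m` finite on compact sets), which identifies `∫ f dm` as the limit of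
  `T gₙ` along ANY dominated approximating sequence `gₙ ∈ 𝓓` of `f`;
* `measure_ext_of_integral_eq_on_dominatedDense` — uniqueness: regular measures whose integrals
  agree on a dominated-dense `𝓓` are equal;
* `exists_isCompact_monotone_iUnion_eq_of_isOpen` — an open subset of a second countable locally
  compact space is an increasing union of compact sets;
* `measurable_measure_of_forall_isOpen` — a family `M : Ω → Measure Y` of measures finite on
  compact sets is measurable (Giry σ-algebra) as soon as `S ↦ M S U` is measurable for every open
  `U` (π-λ on the finite restrictions to a relatively compact open exhaustion);
* `measurable_measure_isOpen_of_forall_measurable_integral` — `S ↦ M S U` (`U` open) is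
  measurable as soon as `S ↦ ∫ f d(M S)` is measurable for every `f ∈ C_c(Y, ℝ)` (Urysohn
  functions of a compact exhaustion of `U`: `M S U = ⨆ₙ ∫ fₙ d(M S)`);
* `exists_measurable_kernel_integral_eq_on_dominatedDense` — if every `T S` is additive,
  `ℚ`-homogeneous and positive on `𝓓`, there is a MEASURABLE family `M : Ω → Measure Y` of
  regular measures with `∫ f d(M S) = T S f` for all `S` and all `f ∈ 𝓓` (pointwise
  `exists_regular_measure_integral_eq_on_dominatedDense`; measurability of `S ↦ ∫ f d(M S)` for
  all `f ∈ C_c` because it is the pointwise limit of `S ↦ T S gₙ` along dominated approximants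
  `gₙ ∈ 𝓓` of `f`, `abs_integral_sub_le_of_abs_sub_le`);
* `exists_measurable_kernel_integral_eq_ae_on_dominatedDense` — the same when the three
  properties of `T S` only hold for `μ`-a.e. `S`: a measurable kernel of regular measures, finite
  on compact sets for EVERY `S`, representing `T S` on `𝓓` for `μ`-a.e. `S` (replace `T` by `0`
  on a measurable null set containing the bad `S`).

No named fact, no new definition; Mathlib only.  NOT here: existence of `𝓓`
(`CountableTestFamily.lean`), the extension of `T S` to a positive linear functional and its
Riesz–Markov representation (`RieszMarkovKernel.lean`), vague-measurability of `S ↦ M S` as a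
map into a topological space of Radon measures.

## References

* W. Rudin, *Real and Complex Analysis*, 3rd ed. (1987), Thm. 2.14 and Thm. 2.18 (Riesz
  representation; regularity on σ-compact spaces). [Rudin1987]
* O. Kallenberg, *Random Measures, Theory and Applications* (2017), Lemma 1.14 and §4.1
  (measurability of random measures via countable classes) — standard. [folklore]
-/

noncomputable section

open Set Filter Function
open _root_.MeasureTheory _root_.Topology
open scoped CompactlySupported ENNReal

namespace Literature.Probability.Distributions

section Integral

variable {Y : Type*} [TopologicalSpace Y] [MeasurableSpace Y]

/-- **Domination estimate for integrals.**  If `m` is finite on compact sets and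
`f, g, χ ∈ C_c(Y, ℝ)` satisfy `|f x - g x| ≤ η * χ x` for all `x`, then
`|∫ f dm - ∫ g dm| ≤ η * ∫ χ dm`.  With `exists_regular_measure_integral_eq_on_dominatedDense`
this identifies `∫ f dm` as the limit of `T gₙ` along any dominated approximating sequence
`gₙ ∈ 𝓓` of `f`. [folklore] -/
theorem abs_integral_sub_le_of_abs_sub_le [OpensMeasurableSpace Y] (m : Measure Y)
    [IsFiniteMeasureOnCompacts m] (f g χ : C_c(Y, ℝ)) {η : ℝ}
    (h : ∀ x, |f x - g x| ≤ η * χ x) :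
    |∫ x, f x ∂m - ∫ x, g x ∂m| ≤ η * ∫ x, χ x ∂m := by
  rw [← integral_sub f.integrable g.integrable, ← integral_const_mul]
  refine abs_integral_le_integral_abs.trans (integral_mono (f.integrable.sub g.integrable).abs
    (χ.integrable.const_mul η) fun x => ?_)
  exact h x

/-- **Uniqueness.**  Two regular Borel measures on a locally compact `T2` space whose integrals
agree on a dominated-dense family `𝓓 ⊆ C_c(Y, ℝ)` are equal: by the domination estimate their
integrals agree on all of `C_c(Y, ℝ)` (`|∫ f dm - ∫ f dm'| ≤ η (∫ χ dm + ∫ χ dm')` for every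
`η > 0`), and regular measures are determined by these
(`MeasureTheory.Measure.ext_of_integral_eq_on_compactlySupported`). [folklore] -/
theorem measure_ext_of_integral_eq_on_dominatedDense [T2Space Y] [LocallyCompactSpace Y]
    [BorelSpace Y] {𝓓 : Set C_c(Y, ℝ)}
    (hdense : ∀ K : Set Y, IsCompact K → ∃ χ ∈ 𝓓, (∀ x, χ x ∈ Icc (0 : ℝ) 1) ∧ (∀ x ∈ K, χ x = 1) ∧
      ∀ f : C_c(Y, ℝ), support f ⊆ K → ∀ η : ℝ, 0 < η → ∃ g ∈ 𝓓, ∀ x, |f x - g x| ≤ η * χ x)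
    {m m' : Measure Y} [m.Regular] [m'.Regular] (h : ∀ f ∈ 𝓓, ∫ x, f x ∂m = ∫ x, f x ∂m') :
    m = m' := by
  refine Measure.ext_of_integral_eq_on_compactlySupported fun f => ?_
  obtain ⟨χ, hχ, h01, -, happrox⟩ := hdense (tsupport f) f.hasCompactSupport
  have hC : 0 ≤ ∫ x, χ x ∂m + ∫ x, χ x ∂m' :=
    add_nonneg (integral_nonneg fun x => (h01 x).1) (integral_nonneg fun x => (h01 x).1)
  have hb : ∀ η : ℝ, 0 < η →
      |∫ x, f x ∂m - ∫ x, f x ∂m'| ≤ η * (∫ x, χ x ∂m + ∫ x, χ x ∂m') := fun η hη => by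
    obtain ⟨g, hg, hfg⟩ := happrox f (subset_tsupport _) η hη
    calc |∫ x, f x ∂m - ∫ x, f x ∂m'|
        ≤ |∫ x, f x ∂m - ∫ x, g x ∂m| + |∫ x, g x ∂m - ∫ x, f x ∂m'| := abs_sub_le _ _ _
      _ ≤ η * ∫ x, χ x ∂m + η * ∫ x, χ x ∂m' := by
          refine add_le_add (abs_integral_sub_le_of_abs_sub_le m f g χ hfg) ?_
          rw [h g hg, abs_sub_comm]
          exact abs_integral_sub_le_of_abs_sub_le m' f g χ hfg
      _ = η * (∫ x, χ x ∂m + ∫ x, χ x ∂m') := by ring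
  have hle : |∫ x, f x ∂m - ∫ x, f x ∂m'| ≤ 0 := by
    refine le_of_forall_pos_le_add fun ε hε => ?_
    have hpos : 0 < ε / (∫ x, χ x ∂m + ∫ x, χ x ∂m' + 1) := div_pos hε (by linarith)
    calc |∫ x, f x ∂m - ∫ x, f x ∂m'|
        ≤ ε / (∫ x, χ x ∂m + ∫ x, χ x ∂m' + 1) * (∫ x, χ x ∂m + ∫ x, χ x ∂m') := hb _ hpos
      _ = ε * ((∫ x, χ x ∂m + ∫ x, χ x ∂m') / (∫ x, χ x ∂m + ∫ x, χ x ∂m' + 1)) := by ring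
      _ ≤ ε * 1 := by
          gcongr
          exact (div_le_one (by linarith)).mpr (by linarith)
      _ = 0 + ε := by ring
  have h0 := abs_nonpos_iff.mp hle
  linarith

end Integral

section OpenSets

variable {Ω Y : Type*} [MeasurableSpace Ω] [TopologicalSpace Y]

omit [MeasurableSpace Ω] in
/-- **Compact exhaustion of an open set.**  In a second countable locally compact space every
open set `U` is the increasing union of a sequence of compact subsets (the open subspace `U` is
itself second countable and locally compact, hence σ-compact). [folklore] -/
theorem exists_isCompact_monotone_iUnion_eq_of_isOpen [LocallyCompactSpace Y]
    [SecondCountableTopology Y] {U : Set Y} (hU : IsOpen U) :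
    ∃ K : ℕ → Set Y, (∀ n, IsCompact (K n)) ∧ (∀ n, K n ⊆ U) ∧ Monotone K ∧ ⋃ n, K n = U := by
  haveI : LocallyCompactSpace U := hU.locallyCompactSpace
  refine ⟨fun n => (↑) '' compactCovering U n,
    fun n => (isCompact_compactCovering U n).image continuous_subtype_val,
    fun n => Subtype.coe_image_subset _ _,
    fun m n hmn => image_mono (compactCovering_subset U hmn), ?_⟩
  rw [← image_iUnion, iUnion_compactCovering, image_univ, Subtype.range_coe]

/-- **Measurability of a locally finite kernel from open sets.**  Let `Y` be second countable
and locally compact with its Borel σ-algebra, and `M : Ω → Measure Y` a family of measures finite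
on compact sets.  If `S ↦ M S U` is measurable for every open `U`, then `M` is measurable for
the Giry σ-algebra, i.e. `S ↦ M S s` is measurable for every measurable `s` (the restrictions of
`M S` to an increasing sequence of relatively compact open sets `Vₙ` covering `Y` are finite
kernels determined on the π-system of open sets, and `M S s = ⨆ₙ M S (s ∩ Vₙ)`). [folklore] -/
theorem measurable_measure_of_forall_isOpen [LocallyCompactSpace Y] [SecondCountableTopology Y]
    [MeasurableSpace Y] [BorelSpace Y] {M : Ω → Measure Y}
    (hfin : ∀ S, IsFiniteMeasureOnCompacts (M S))
    (hU : ∀ U : Set Y, IsOpen U → Measurable fun S => M S U) : Measurable M := by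
  -- an increasing sequence of relatively compact open sets covering `Y`
  set K : CompactExhaustion Y := CompactExhaustion.choice Y
  set V : ℕ → Set Y := fun n => interior (K (n + 1)) with hV
  have hVopen : ∀ n, IsOpen (V n) := fun n => isOpen_interior
  have hVmono : Monotone V := fun m n hmn => interior_mono (K.subset (Nat.succ_le_succ hmn))
  have hVuniv : ⋃ n, V n = univ := eq_univ_of_forall fun x => by
    obtain ⟨n, hn⟩ := K.exists_mem x
    exact mem_iUnion.mpr ⟨n, K.subset_interior_succ n hn⟩
  have hVfin : ∀ S n, M S (V n) < ∞ := fun S n => by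
    haveI := hfin S
    exact (measure_mono interior_subset).trans_lt (K.isCompact (n + 1)).measure_lt_top
  -- the restricted kernels are finite, hence measurable by π-λ on open sets
  have hres : ∀ n, Measurable fun S => (M S).restrict (V n) := fun n => by
    haveI : ∀ S, IsFiniteMeasure ((M S).restrict (V n)) := fun S =>
      ⟨by rw [Measure.restrict_apply_univ]; exact hVfin S n⟩
    refine Measurable.measure_of_isPiSystem (S := {U | IsOpen U}) BorelSpace.measurable_eq
      isPiSystem_isOpen (fun U hU' => ?_) ?_
    · simp_rw [Measure.restrict_apply' (hVopen n).measurableSet]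
      exact hU _ (IsOpen.inter hU' (hVopen n))
    · simp_rw [Measure.restrict_apply_univ]
      exact hU _ (hVopen n)
  refine Measure.measurable_of_measurable_coe M fun s hs => ?_
  have heq : ∀ S, M S s = ⨆ n, (M S).restrict (V n) s := fun S => by
    simp_rw [Measure.restrict_apply hs]
    rw [← (monotone_const.inter hVmono).measure_iUnion, ← inter_iUnion, hVuniv, inter_univ]
  simp_rw [heq]
  exact Measurable.iSup fun n => (Measure.measurable_coe hs).comp (hres n)

/-- **Open sets from test functions.**  Let `Y` be second countable, locally compact and `T2`
with its Borel σ-algebra, and `M : Ω → Measure Y` a family of measures finite on compact sets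
such that `S ↦ ∫ f d(M S)` is measurable for every `f ∈ C_c(Y, ℝ)`.  Then `S ↦ M S U` is
measurable for every open `U`: with `Kₙ ↑ U` compact and Urysohn functions `fₙ ∈ C_c`,
`fₙ = 1` on `Kₙ`, `0 ≤ fₙ ≤ 1`, `tsupport fₙ ⊆ U`, one has `M S U = ⨆ₙ ∫ fₙ d(M S)`.
[folklore] -/
theorem measurable_measure_isOpen_of_forall_measurable_integral [T2Space Y]
    [LocallyCompactSpace Y] [SecondCountableTopology Y] [MeasurableSpace Y] [BorelSpace Y]
    {M : Ω → Measure Y} (hfin : ∀ S, IsFiniteMeasureOnCompacts (M S))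
    (hint : ∀ f : C_c(Y, ℝ), Measurable fun S => ∫ x, f x ∂(M S)) {U : Set Y} (hU : IsOpen U) :
    Measurable fun S => M S U := by
  obtain ⟨K, hKc, hKU, hKmono, hKunion⟩ := exists_isCompact_monotone_iUnion_eq_of_isOpen hU
  have hury : ∀ n, ∃ f : C_c(Y, ℝ), EqOn f 1 (K n) ∧ tsupport f ⊆ U ∧ ∀ x, f x ∈ Icc (0 : ℝ) 1 :=
    fun n => by
    obtain ⟨f, hf1, hf2, hf3, hf4⟩ :=
      exists_continuousMap_one_of_isCompact_subset_isOpen (hKc n) hU (hKU n)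
    exact ⟨⟨f, hf2⟩, hf1, hf3, hf4⟩
  choose f hf1 hfU hf01 using hury
  have hlin : ∀ S n, ENNReal.ofReal (∫ x, f n x ∂(M S)) = ∫⁻ x, ENNReal.ofReal (f n x) ∂(M S) :=
    fun S n => by
    haveI := hfin S
    exact ofReal_integral_eq_lintegral_ofReal (f n).integrable
      (Eventually.of_forall fun x => (hf01 n x).1)
  have heq : ∀ S, M S U = ⨆ n, ENNReal.ofReal (∫ x, f n x ∂(M S)) := fun S => by
    apply le_antisymm
    · rw [← hKunion, hKmono.measure_iUnion]
      refine iSup_mono fun n => ?_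
      rw [hlin, ← lintegral_indicator_one (hKc n).measurableSet]
      refine lintegral_mono fun x => ?_
      by_cases hx : x ∈ K n
      · rw [indicator_of_mem hx, Pi.one_apply, show f n x = 1 from hf1 n hx, ENNReal.ofReal_one]
      · rw [indicator_of_notMem hx]
        exact zero_le
    · refine iSup_le fun n => ?_
      rw [hlin, ← lintegral_indicator_one hU.measurableSet]
      refine lintegral_mono fun x => ?_
      by_cases hx : x ∈ U
      · rw [indicator_of_mem hx, Pi.one_apply, ← ENNReal.ofReal_one]
        exact ENNReal.ofReal_le_ofReal (hf01 n x).2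
      · rw [indicator_of_notMem hx, image_eq_zero_of_notMem_tsupport fun h => hx (hfU n h),
          ENNReal.ofReal_zero]
  simp_rw [heq]
  exact Measurable.iSup fun n => ENNReal.measurable_ofReal.comp (hint (f n))

end OpenSets

section Kernel

variable {Ω Y : Type*} [MeasurableSpace Ω] [TopologicalSpace Y] [T2Space Y] [LocallyCompactSpace Y]
  [SecondCountableTopology Y] [MeasurableSpace Y] [BorelSpace Y] {𝓓 : Set C_c(Y, ℝ)}

/-- **Measurable Riesz–Markov kernel (sure version).**  Let `𝓓 ⊆ C_c(Y, ℝ)` be closed under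
`+` and rational multiples and dominated-dense, and `T : Ω → C_c(Y, ℝ) → ℝ` with `S ↦ T S f`
measurable for `f ∈ 𝓓` and every `T S` additive, `ℚ`-homogeneous and positive on `𝓓`.  Then
there is a measurable family `M : Ω → Measure Y` of regular Borel measures (finite on compact
sets) with `∫ f d(M S) = T S f` for all `S` and all `f ∈ 𝓓`.  Measurability: for `f ∈ C_c` and
dominated approximants `gₙ ∈ 𝓓`, `|f - gₙ| ≤ χ / (n + 1)`, one has
`|∫ f d(M S) - T S gₙ| ≤ T S χ / (n + 1)`, so `S ↦ ∫ f d(M S)` is a pointwise limit of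
measurable functions; then open sets and the Giry σ-algebra by the two lemmas above.
[cite: Rudin1987, Thm. 2.14] -/
theorem exists_measurable_kernel_integral_eq_on_dominatedDense
    (hadd : ∀ f ∈ 𝓓, ∀ g ∈ 𝓓, f + g ∈ 𝓓) (hsmul : ∀ (q : ℚ), ∀ f ∈ 𝓓, (q : ℝ) • f ∈ 𝓓)
    (hdense : ∀ K : Set Y, IsCompact K → ∃ χ ∈ 𝓓, (∀ x, χ x ∈ Icc (0 : ℝ) 1) ∧ (∀ x ∈ K, χ x = 1) ∧
      ∀ f : C_c(Y, ℝ), support f ⊆ K → ∀ η : ℝ, 0 < η → ∃ g ∈ 𝓓, ∀ x, |f x - g x| ≤ η * χ x)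
    {T : Ω → C_c(Y, ℝ) → ℝ} (hTmeas : ∀ f ∈ 𝓓, Measurable fun S => T S f)
    (hTadd : ∀ S, ∀ f ∈ 𝓓, ∀ g ∈ 𝓓, T S (f + g) = T S f + T S g)
    (hThom : ∀ S (q : ℚ), ∀ f ∈ 𝓓, T S ((q : ℝ) • f) = (q : ℝ) * T S f)
    (hTpos : ∀ S, ∀ f ∈ 𝓓, (∀ x, 0 ≤ f x) → 0 ≤ T S f) :
    ∃ M : Ω → Measure Y, Measurable M ∧ (∀ S, (M S).Regular) ∧
      ∀ S, ∀ f ∈ 𝓓, ∫ x, f x ∂(M S) = T S f := by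
  choose M hMreg hM using fun S =>
    exists_regular_measure_integral_eq_on_dominatedDense hadd hsmul hdense (hTadd S) (hThom S)
      (hTpos S)
  have hfin : ∀ S, IsFiniteMeasureOnCompacts (M S) := fun S => inferInstance
  -- measurability of the integrals of ALL test functions
  have hint : ∀ f : C_c(Y, ℝ), Measurable fun S => ∫ x, f x ∂(M S) := fun f => by
    obtain ⟨χ, hχ, -, -, happrox⟩ := hdense (tsupport f) f.hasCompactSupport
    choose g hg hfg using fun n : ℕ =>
      happrox f (subset_tsupport _) (1 / ((n : ℝ) + 1)) (by positivity)
    refine measurable_of_tendsto_metrizable (f := fun n S => T S (g n))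
      (fun n => hTmeas _ (hg n)) (tendsto_pi_nhds.mpr fun S => ?_)
    have hb : ∀ n, |T S (g n) - ∫ x, f x ∂(M S)| ≤ 1 / ((n : ℝ) + 1) * T S χ := fun n => by
      rw [← hM S _ (hg n), ← hM S _ hχ, abs_sub_comm]
      exact abs_integral_sub_le_of_abs_sub_le (M S) f (g n) χ (hfg n)
    have h0 : Tendsto (fun n : ℕ => 1 / ((n : ℝ) + 1) * T S χ) atTop (𝓝 0) := by
      have h := (tendsto_one_div_add_atTop_nhds_zero_nat (𝕜 := ℝ)).mul_const (T S χ)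
      rwa [zero_mul] at h
    exact tendsto_sub_nhds_zero_iff.mp
      (squeeze_zero_norm (fun n => by rw [Real.norm_eq_abs]; exact hb n) h0)
  exact ⟨M, measurable_measure_of_forall_isOpen hfin fun U hU =>
    measurable_measure_isOpen_of_forall_measurable_integral hfin hint hU, hMreg, hM⟩

/-- **Measurable Riesz–Markov kernel (a.e. version).**  Let `μ` be a measure on `Ω`,
`𝓓 ⊆ C_c(Y, ℝ)` closed under `+` and rational multiples and dominated-dense, and
`T : Ω → C_c(Y, ℝ) → ℝ` with `S ↦ T S f` measurable for `f ∈ 𝓓` and, for `μ`-a.e. `S`, `T S`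
additive, `ℚ`-homogeneous and positive on `𝓓`.  Then there is a measurable family
`M : Ω → Measure Y` of regular Borel measures, finite on compact sets for EVERY `S`, with
`∫ f d(M S) = T S f` for all `f ∈ 𝓓`, for `μ`-a.e. `S` (apply the sure version to `T`
replaced by `0` on a measurable `μ`-null set containing the exceptional `S`).
[cite: Rudin1987, Thm. 2.14] -/
theorem exists_measurable_kernel_integral_eq_ae_on_dominatedDense (μ : Measure Ω)
    (hadd : ∀ f ∈ 𝓓, ∀ g ∈ 𝓓, f + g ∈ 𝓓) (hsmul : ∀ (q : ℚ), ∀ f ∈ 𝓓, (q : ℝ) • f ∈ 𝓓)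
    (hdense : ∀ K : Set Y, IsCompact K → ∃ χ ∈ 𝓓, (∀ x, χ x ∈ Icc (0 : ℝ) 1) ∧ (∀ x ∈ K, χ x = 1) ∧
      ∀ f : C_c(Y, ℝ), support f ⊆ K → ∀ η : ℝ, 0 < η → ∃ g ∈ 𝓓, ∀ x, |f x - g x| ≤ η * χ x)
    {T : Ω → C_c(Y, ℝ) → ℝ} (hTmeas : ∀ f ∈ 𝓓, Measurable fun S => T S f)
    (hTadd : ∀ᵐ S ∂μ, ∀ f ∈ 𝓓, ∀ g ∈ 𝓓, T S (f + g) = T S f + T S g)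
    (hThom : ∀ᵐ S ∂μ, ∀ (q : ℚ), ∀ f ∈ 𝓓, T S ((q : ℝ) • f) = (q : ℝ) * T S f)
    (hTpos : ∀ᵐ S ∂μ, ∀ f ∈ 𝓓, (∀ x, 0 ≤ f x) → 0 ≤ T S f) :
    ∃ M : Ω → Measure Y, Measurable M ∧ (∀ S, (M S).Regular) ∧
      (∀ S (K : Set Y), IsCompact K → M S K < ∞) ∧
      ∀ᵐ S ∂μ, ∀ f ∈ 𝓓, ∫ x, f x ∂(M S) = T S f := by
  classical
  -- a measurable null set `N` off which the three properties hold
  have hae := (hTadd.and hThom).and hTpos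
  rw [ae_iff] at hae
  obtain ⟨N, hNsub, hNmeas, hN0⟩ := exists_measurable_superset_of_null hae
  have hgood : ∀ S, S ∉ N →
      ((∀ f ∈ 𝓓, ∀ g ∈ 𝓓, T S (f + g) = T S f + T S g) ∧
        ∀ (q : ℚ), ∀ f ∈ 𝓓, T S ((q : ℝ) • f) = (q : ℝ) * T S f) ∧
      ∀ f ∈ 𝓓, (∀ x, 0 ≤ f x) → 0 ≤ T S f :=
    fun S hS => not_not.mp fun h => hS (hNsub h)
  -- the modified family
  set T' : Ω → C_c(Y, ℝ) → ℝ := fun S f => if S ∈ N then 0 else T S f with hT'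
  have hT'meas : ∀ f ∈ 𝓓, Measurable fun S => T' S f := fun f hf =>
    Measurable.ite hNmeas measurable_const (hTmeas f hf)
  have hT'add : ∀ S, ∀ f ∈ 𝓓, ∀ g ∈ 𝓓, T' S (f + g) = T' S f + T' S g := fun S f hf g hg => by
    by_cases hS : S ∈ N
    · simp [T', hS]
    · simpa [T', hS] using (hgood S hS).1.1 f hf g hg
  have hT'hom : ∀ S (q : ℚ), ∀ f ∈ 𝓓, T' S ((q : ℝ) • f) = (q : ℝ) * T' S f := fun S q f hf => by
    by_cases hS : S ∈ N
    · simp [T', hS]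
    · simpa [T', hS] using (hgood S hS).1.2 q f hf
  have hT'pos : ∀ S, ∀ f ∈ 𝓓, (∀ x, 0 ≤ f x) → 0 ≤ T' S f := fun S f hf hf0 => by
    by_cases hS : S ∈ N
    · simp [T', hS]
    · simpa [T', hS] using (hgood S hS).2 f hf hf0
  obtain ⟨M, hMmeas, hMreg, hM⟩ := exists_measurable_kernel_integral_eq_on_dominatedDense hadd
    hsmul hdense hT'meas hT'add hT'hom hT'pos
  refine ⟨M, hMmeas, hMreg, fun S K hK => ?_, ?_⟩
  · haveI := hMreg S
    exact hK.measure_lt_top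
  · have hNae : ∀ᵐ S ∂μ, S ∉ N := compl_mem_ae_iff.mpr hN0
    filter_upwards [hNae] with S hS f hf
    rw [hM S f hf]
    simp [T', hS]

end Kernel

end Literature.Probability.Distributions

end
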